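import Mathlib

/-!
# NE7WilsonLagrange — row NE7 (node U5), candidate route HOM ∕ H1L-EJ, EJ-1b′ (the one-step SIGN question): LENS 2's (J1) IN KERNEL — the EXACT
# non-abelian WITHIN-LOOP identity `n·Σᵢ w(Uᵢ) − w(U₀⋯U_{n−1}) = ¼ Σᵢ Σⱼ ‖bᵢ − bⱼ‖²_HS` for unitary matrices, `w = Re Tr(1 − ·)`,
# `bᵢ := U₀⋯U_{i−1}(1 − Uᵢ)` (telescoping + Lagrange; the Hilbert–Schmidt equality case behind the tree's `B8Ineq170.norm_dprod_sub_one_le`)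

Lineage `b2b-balaban-t4-ne7-p2` (CRUX PROVER NE7 #2 = C-HOM°'s kernel hand), generation 81; file 120.  Mathlib-only imports.

SOURCE (lens 2 = `t4-ne7-idea-2` gen 101, `t4/ideate/NE7/lens2-g101/SIGN-SUPPLY.md` 0563b417492bac44 §2, S-101-1; INBOX L.49660 → p2: «(J1) is
kernel-typable folklore if a CRUX prover ever files»): «(J1) EXACT identity n·Σ_i w(U_i) − w(U₁⋯U_n) = ½Σ_{i<j}‖b_i − b_j‖²_HS, b_i :=
U₁⋯U_{i−1}(1−U_i) (w = ReTr(1−·); telescoping + Lagrange; the HS equality case of the tree's `B8Ineq170.norm_dprod_sub_one_le`) = the non-abelian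
WITHIN-LOOP margin with its deficit named».  (Here 0-indexed: `U₀, …, U_{n−1}`, `bᵢ = pp U i · (1 − Uᵢ)` with `pp U i = U₀⋯U_{i−1}`; the
symmetric double sum `¼ΣᵢΣⱼ` equals lens 2's `½Σ_{i<j}`.)  THIS FILE:
* §1 the real Hilbert–Schmidt pairing `hsInner A B := Re Tr(AᴴB)` on `Matrix N N ℂ`: symmetry, bilinearity over sums, `hsNormSq A = Σ‖A_ij‖² ≥ 0`,
  `hsNormSq_sub` (polarisation), **`hsInner_unitary_mul`** (left multiplication by `V` with `VᴴV = 1` is an isometry).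
* §2 **`lagrange_identity`**: `n·Σ_{i<n}‖xᵢ‖² − ‖Σ_{i<n} xᵢ‖² = ½Σ_{i<n}Σ_{j<n}‖xᵢ − xⱼ‖²` for any family of matrices. [folklore]
* §3 the Wilson weight `wil U := Re Tr(1 − U)`, **`wil_eq_half_hsNormSq`** (`w(U) = ½‖1 − U‖²_HS` when `UᴴU = 1`); ascending partial products
  `pp`, `pp_unitary`, the increments `bvec U i := pp U i·(1 − Uᵢ) = pp U i − pp U (i+1)`, **`sum_bvec`** (telescoping `Σ_{i<n} bᵢ = 1 − pp U n`),
  `hsNormSq_bvec` (`‖bᵢ‖² = ‖1 − Uᵢ‖²`).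
* §4 **`wilson_lagrange`** = (J1); **`wil_pp_le`** (`w(U₀⋯U_{n−1}) ≤ n·Σᵢ w(Uᵢ)`, the quadratic within-loop bound); the `unitaryGroup` forms.

HONEST FRAMING: [folklore] (an algebraic identity for unitary matrices; no lattice, no average, no action); it is a TOTAL ∕ within-loop identity —
PRICING-NE7 v50 T-50-10's named exception («the (J1) identity … excepted»), NOT a per-cell ∕ per-plaquette non-abelian Jensen for (42) (lens 2's
F2∕F3 show those are false); nothing of Bałaban's instantiated; CONJECTURE M neither used nor touched; NOT a letter move.  NE7 NOT PRINTED ∕ NOT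
PROVED; spine 0∕9; FIXED FINITE T⁴, rung (B)+1; NOT infinite volume, NOT mass gap, NOT Clay.  HONEST DEPENDENCY: continuum YM on T⁴ ⇐ BetaPertH ∧
nine spine estimates (0/9 proved); BetaPertH ⇐ (D1) ∧ (D4) ∧ CAP+tail; G-an2-4 gates asym, D1 and NE2/3/4.
-/

noncomputable section

open Matrix Finset

namespace Summit.QuantumFields.BalabanUV.T4Continuum.NE7WilsonLagrange

variable {N : Type*} [Fintype N] [DecidableEq N]

/-! ### §1 The real Hilbert–Schmidt pairing on `Matrix N N ℂ` -/

/-- `⟪A, B⟫_HS := Re Tr(AᴴB)` — the real Hilbert–Schmidt (Frobenius) pairing. [folklore] -/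
def hsInner (A B : Matrix N N ℂ) : ℝ := (Aᴴ * B).trace.re

/-- `‖A‖²_HS := Re Tr(AᴴA)`. [folklore] -/
def hsNormSq (A : Matrix N N ℂ) : ℝ := hsInner A A

omit [DecidableEq N] in
/-- `⟪A, B⟫ = Re Σ_{i,j} conj(A_ij) B_ij`. [folklore] -/
theorem hsInner_eq_sum (A B : Matrix N N ℂ) : hsInner A B = ∑ i, ∑ j, (starRingEnd ℂ (A i j) * B i j).re := by
  unfold hsInner
  rw [Matrix.trace, Complex.re_sum, Finset.sum_comm]
  refine sum_congr rfl fun i _ => ?_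
  rw [Matrix.diag_apply, Matrix.mul_apply, Complex.re_sum]
  refine sum_congr rfl fun j _ => ?_
  rw [conjTranspose_apply]; rfl

omit [DecidableEq N] in
/-- `‖A‖²_HS = Σ_{i,j} ‖A_ij‖²`. [folklore] -/
theorem hsNormSq_eq_sum (A : Matrix N N ℂ) : hsNormSq A = ∑ i, ∑ j, ‖A i j‖ ^ 2 := by
  unfold hsNormSq
  rw [hsInner_eq_sum]
  refine sum_congr rfl fun i _ => sum_congr rfl fun j _ => ?_
  rw [Complex.conj_mul', ← Complex.ofReal_pow, Complex.ofReal_re]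

omit [DecidableEq N] in
/-- `0 ≤ ‖A‖²_HS`. [folklore] -/
theorem hsNormSq_nonneg (A : Matrix N N ℂ) : 0 ≤ hsNormSq A := by
  rw [hsNormSq_eq_sum]; positivity

omit [DecidableEq N] in
/-- symmetry `⟪A, B⟫ = ⟪B, A⟫` (`Re Tr(AᴴB) = Re conj Tr(BᴴA)`). [folklore] -/
theorem hsInner_comm (A B : Matrix N N ℂ) : hsInner A B = hsInner B A := by
  unfold hsInner
  rw [← conjTranspose_conjTranspose B, ← conjTranspose_mul, trace_conjTranspose, conjTranspose_conjTranspose, Complex.star_def,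
    Complex.conj_re]

omit [DecidableEq N] in
/-- additivity in the second slot. [folklore] -/
theorem hsInner_add_right (A B C : Matrix N N ℂ) : hsInner A (B + C) = hsInner A B + hsInner A C := by
  unfold hsInner; rw [Matrix.mul_add, trace_add, Complex.add_re]

omit [DecidableEq N] in
/-- subtraction in the second slot. [folklore] -/
theorem hsInner_sub_right (A B C : Matrix N N ℂ) : hsInner A (B - C) = hsInner A B - hsInner A C := by
  unfold hsInner; rw [Matrix.mul_sub, trace_sub, Complex.sub_re]

omit [DecidableEq N] in
/-- subtraction in the first slot. [folklore] -/
theorem hsInner_sub_left (A B C : Matrix N N ℂ) : hsInner (A - B) C = hsInner A C - hsInner B C := by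
  rw [hsInner_comm, hsInner_sub_right, hsInner_comm C A, hsInner_comm C B]

omit [DecidableEq N] in
/-- sums in the second slot. [folklore] -/
theorem hsInner_sum_right {ι : Type*} (s : Finset ι) (A : Matrix N N ℂ) (x : ι → Matrix N N ℂ) :
    hsInner A (∑ i ∈ s, x i) = ∑ i ∈ s, hsInner A (x i) := by
  unfold hsInner; rw [Finset.mul_sum, trace_sum, Complex.re_sum]

omit [DecidableEq N] in
/-- sums in the first slot. [folklore] -/
theorem hsInner_sum_left {ι : Type*} (s : Finset ι) (x : ι → Matrix N N ℂ) (B : Matrix N N ℂ) :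
    hsInner (∑ i ∈ s, x i) B = ∑ i ∈ s, hsInner (x i) B := by
  rw [hsInner_comm, hsInner_sum_right]
  exact sum_congr rfl fun i _ => hsInner_comm _ _

omit [DecidableEq N] in
/-- **polarisation**: `‖A − B‖² = ‖A‖² + ‖B‖² − 2⟪A, B⟫`. [folklore] -/
theorem hsNormSq_sub (A B : Matrix N N ℂ) : hsNormSq (A - B) = hsNormSq A + hsNormSq B - 2 * hsInner A B := by
  unfold hsNormSq
  rw [hsInner_sub_left, hsInner_sub_right, hsInner_sub_right, hsInner_comm B A]
  ring

omit [DecidableEq N] in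
/-- `‖Σᵢ xᵢ‖² = Σᵢ Σⱼ ⟪xᵢ, xⱼ⟫`. [folklore] -/
theorem hsNormSq_sum {ι : Type*} (s : Finset ι) (x : ι → Matrix N N ℂ) :
    hsNormSq (∑ i ∈ s, x i) = ∑ i ∈ s, ∑ j ∈ s, hsInner (x i) (x j) := by
  unfold hsNormSq
  rw [hsInner_sum_left]
  exact sum_congr rfl fun i _ => hsInner_sum_right s _ _

/-- **isometry of left multiplication by a unitary**: `⟪VA, VB⟫ = ⟪A, B⟫` when `VᴴV = 1`. [folklore] -/
theorem hsInner_unitary_mul {V : Matrix N N ℂ} (hV : Vᴴ * V = 1) (A B : Matrix N N ℂ) : hsInner (V * A) (V * B) = hsInner A B := by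
  unfold hsInner
  rw [conjTranspose_mul, Matrix.mul_assoc, ← Matrix.mul_assoc Vᴴ, hV, Matrix.one_mul]

/-- hence `‖VA‖² = ‖A‖²` when `VᴴV = 1`. [folklore] -/
theorem hsNormSq_unitary_mul {V : Matrix N N ℂ} (hV : Vᴴ * V = 1) (A : Matrix N N ℂ) : hsNormSq (V * A) = hsNormSq A :=
  hsInner_unitary_mul hV A A

/-! ### §2 The Lagrange identity -/

omit [DecidableEq N] in
/-- **LAGRANGE IDENTITY** in the Hilbert–Schmidt pairing: `n·Σ_{i<n}‖xᵢ‖² − ‖Σ_{i<n} xᵢ‖² = ½ Σ_{i<n} Σ_{j<n} ‖xᵢ − xⱼ‖²`. [folklore] -/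
theorem lagrange_identity (x : ℕ → Matrix N N ℂ) (n : ℕ) :
    (n : ℝ) * ∑ i ∈ range n, hsNormSq (x i) - hsNormSq (∑ i ∈ range n, x i)
      = (1 / 2) * ∑ i ∈ range n, ∑ j ∈ range n, hsNormSq (x i - x j) := by
  rw [hsNormSq_sum]
  simp only [hsNormSq_sub, sum_sub_distrib, sum_add_distrib, ← mul_sum, sum_const, card_range, nsmul_eq_mul]
  unfold hsNormSq
  ring

/-! ### §3 The Wilson weight, partial products and their increments -/

/-- the WILSON WEIGHT `w(U) := Re Tr(1 − U)` (`= N − Re Tr U`). [folklore] -/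
def wil (U : Matrix N N ℂ) : ℝ := ((1 : Matrix N N ℂ) - U).trace.re

/-- `w(U) = Re Tr 1 − Re Tr U`. [folklore] -/
theorem wil_eq (U : Matrix N N ℂ) : wil U = ((1 : Matrix N N ℂ)).trace.re - U.trace.re := by
  unfold wil; rw [trace_sub, Complex.sub_re]

omit [DecidableEq N] in
/-- `Re Tr Uᴴ = Re Tr U`. [folklore] -/
theorem re_trace_conjTranspose (U : Matrix N N ℂ) : (Uᴴ).trace.re = U.trace.re := by
  rw [trace_conjTranspose, Complex.star_def, Complex.conj_re]

/-- **`w(U) = ½‖1 − U‖²_HS` for `UᴴU = 1`** (`(1−U)ᴴ(1−U) = 2·1 − U − Uᴴ`). [folklore] -/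
theorem wil_eq_half_hsNormSq {U : Matrix N N ℂ} (hU : Uᴴ * U = 1) : wil U = (1 / 2) * hsNormSq (1 - U) := by
  unfold hsNormSq hsInner
  rw [conjTranspose_sub, conjTranspose_one, Matrix.sub_mul, Matrix.mul_sub, Matrix.mul_sub, Matrix.one_mul, Matrix.one_mul,
    Matrix.mul_one, hU, trace_sub, trace_sub, trace_sub, Complex.sub_re, Complex.sub_re, Complex.sub_re, re_trace_conjTranspose, wil_eq]
  ring

/-- ascending partial products `pp U i := U₀ U₁ ⋯ U_{i−1}` (`pp U 0 = 1`). [folklore] -/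
def pp (U : ℕ → Matrix N N ℂ) : ℕ → Matrix N N ℂ
  | 0 => 1
  | i + 1 => pp U i * U i

/-- `pp U 0 = 1`. [folklore] -/
@[simp] theorem pp_zero (U : ℕ → Matrix N N ℂ) : pp U 0 = 1 := rfl

/-- `pp U (i+1) = pp U i · Uᵢ`. [folklore] -/
theorem pp_succ (U : ℕ → Matrix N N ℂ) (i : ℕ) : pp U (i + 1) = pp U i * U i := rfl

/-- partial products of unitaries are unitary: `(pp U i)ᴴ(pp U i) = 1` if `UⱼᴴUⱼ = 1` for `j < i`. [folklore] -/
theorem pp_unitary (U : ℕ → Matrix N N ℂ) : ∀ i : ℕ, (∀ j < i, (U j)ᴴ * U j = 1) → (pp U i)ᴴ * pp U i = 1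
  | 0, _ => by simp
  | i + 1, h => by
    rw [pp_succ, conjTranspose_mul, Matrix.mul_assoc, ← Matrix.mul_assoc (pp U i)ᴴ, pp_unitary U i fun j hj => h j (Nat.lt_succ_of_lt hj),
      Matrix.one_mul, h i (Nat.lt_succ_self i)]

/-- the increments `bᵢ := pp U i · (1 − Uᵢ)` (lens 2's `b_i = U₁⋯U_{i−1}(1 − U_i)`). [folklore] -/
def bvec (U : ℕ → Matrix N N ℂ) (i : ℕ) : Matrix N N ℂ := pp U i * (1 - U i)

/-- `bᵢ = pp U i − pp U (i+1)`. [folklore] -/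
theorem bvec_eq_sub (U : ℕ → Matrix N N ℂ) (i : ℕ) : bvec U i = pp U i - pp U (i + 1) := by
  unfold bvec; rw [Matrix.mul_sub, Matrix.mul_one, pp_succ]

/-- **telescoping**: `Σ_{i<n} bᵢ = 1 − U₀⋯U_{n−1}`. [folklore] -/
theorem sum_bvec (U : ℕ → Matrix N N ℂ) (n : ℕ) : ∑ i ∈ range n, bvec U i = 1 - pp U n := by
  simp only [bvec_eq_sub]
  rw [Finset.sum_range_sub', pp_zero]

/-- `‖bᵢ‖² = ‖1 − Uᵢ‖²` (isometry of `pp U i`). [folklore] -/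
theorem hsNormSq_bvec (U : ℕ → Matrix N N ℂ) {i : ℕ} (h : ∀ j < i, (U j)ᴴ * U j = 1) : hsNormSq (bvec U i) = hsNormSq (1 - U i) :=
  hsNormSq_unitary_mul (pp_unitary U i h) _

/-! ### §4 (J1): the exact within-loop identity and the quadratic bound -/

/-- **(J1) — LENS 2's EXACT NON-ABELIAN WITHIN-LOOP IDENTITY**: for `U₀, …, U_{n−1}` with `UᵢᴴUᵢ = 1`,
`n·Σ_{i<n} w(Uᵢ) − w(U₀⋯U_{n−1}) = ¼ Σ_{i<n} Σ_{j<n} ‖bᵢ − bⱼ‖²_HS` (`= ½Σ_{i<j}`), `bᵢ = U₀⋯U_{i−1}(1 − Uᵢ)`. [folklore] -/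
theorem wilson_lagrange (U : ℕ → Matrix N N ℂ) (n : ℕ) (hU : ∀ i < n, (U i)ᴴ * U i = 1) :
    (n : ℝ) * ∑ i ∈ range n, wil (U i) - wil (pp U n) = (1 / 4) * ∑ i ∈ range n, ∑ j ∈ range n, hsNormSq (bvec U i - bvec U j) := by
  have hw : ∀ i ∈ range n, wil (U i) = (1 / 2) * hsNormSq (bvec U i) := fun i hi => by
    rw [wil_eq_half_hsNormSq (hU i (mem_range.mp hi)), hsNormSq_bvec U fun j hj => hU j (hj.trans (mem_range.mp hi))]
  rw [sum_congr rfl hw, ← mul_sum, wil_eq_half_hsNormSq (pp_unitary U n hU), ← sum_bvec]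
  have h := lagrange_identity (bvec U) n
  linarith

/-- the deficit is non-negative. [folklore] -/
theorem deficit_nonneg (U : ℕ → Matrix N N ℂ) (n : ℕ) : 0 ≤ (1 / 4) * ∑ i ∈ range n, ∑ j ∈ range n, hsNormSq (bvec U i - bvec U j) :=
  mul_nonneg (by norm_num) (sum_nonneg fun _ _ => sum_nonneg fun _ _ => hsNormSq_nonneg _)

/-- **THE QUADRATIC WITHIN-LOOP BOUND**: `w(U₀⋯U_{n−1}) ≤ n·Σ_{i<n} w(Uᵢ)` for unitary factors — the squared-HS companion of the tree's
linear `B8Ineq170.norm_dprod_sub_one_le`. [folklore] -/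
theorem wil_pp_le (U : ℕ → Matrix N N ℂ) (n : ℕ) (hU : ∀ i < n, (U i)ᴴ * U i = 1) : wil (pp U n) ≤ (n : ℝ) * ∑ i ∈ range n, wil (U i) := by
  have h := wilson_lagrange U n hU
  have h0 := deficit_nonneg U n
  linarith

/-- `0 ≤ w(U)` for `UᴴU = 1`. [folklore] -/
theorem wil_nonneg {U : Matrix N N ℂ} (hU : Uᴴ * U = 1) : 0 ≤ wil U := by
  rw [wil_eq_half_hsNormSq hU]; exact mul_nonneg (by norm_num) (hsNormSq_nonneg _)

/-- the `unitaryGroup` form of (J1): for `Uᵢ ∈ U(N)`. [folklore] -/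
theorem wilson_lagrange_unitaryGroup (U : ℕ → Matrix N N ℂ) (n : ℕ) (hU : ∀ i < n, U i ∈ Matrix.unitaryGroup N ℂ) :
    (n : ℝ) * ∑ i ∈ range n, wil (U i) - wil (pp U n) = (1 / 4) * ∑ i ∈ range n, ∑ j ∈ range n, hsNormSq (bvec U i - bvec U j) :=
  wilson_lagrange U n fun i hi => by
    have h := Matrix.mem_unitaryGroup_iff'.mp (hU i hi)
    rwa [star_eq_conjTranspose] at h

/-- and the bound for `Uᵢ ∈ U(N)`. [folklore] -/
theorem wil_pp_le_unitaryGroup (U : ℕ → Matrix N N ℂ) (n : ℕ) (hU : ∀ i < n, U i ∈ Matrix.unitaryGroup N ℂ) :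
    wil (pp U n) ≤ (n : ℝ) * ∑ i ∈ range n, wil (U i) :=
  wil_pp_le U n fun i hi => by
    have h := Matrix.mem_unitaryGroup_iff'.mp (hU i hi)
    rwa [star_eq_conjTranspose] at h

/-- the two-factor case spelled out: `2(w(U₀) + w(U₁)) − w(U₀U₁) = ½‖b₀ − b₁‖²` with `b₀ = 1 − U₀`, `b₁ = U₀(1 − U₁)`. [folklore] -/
theorem wilson_lagrange_two (U₀ U₁ : Matrix N N ℂ) (h₀ : U₀ᴴ * U₀ = 1) (h₁ : U₁ᴴ * U₁ = 1) :
    2 * (wil U₀ + wil U₁) - wil (U₀ * U₁) = (1 / 2) * hsNormSq ((1 - U₀) - U₀ * (1 - U₁)) := by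
  let U : ℕ → Matrix N N ℂ := fun i => if i = 0 then U₀ else U₁
  have hU : ∀ i < 2, (U i)ᴴ * U i = 1 := fun i hi => by
    interval_cases i <;> simp [U, h₀, h₁]
  have h := wilson_lagrange U 2 hU
  have hpp : pp U 2 = U₀ * U₁ := by simp [pp, U]
  have hb0 : bvec U 0 = 1 - U₀ := by simp [bvec, pp, U]
  have hb1 : bvec U 1 = U₀ * (1 - U₁) := by simp [bvec, pp, U]
  simp only [sum_range_succ, sum_range_zero, zero_add, hpp, hb0, hb1, sub_self] at h
  have hz : hsNormSq (0 : Matrix N N ℂ) = 0 := by simp [hsNormSq, hsInner]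
  have hsymm : hsNormSq (U₀ * (1 - U₁) - (1 - U₀)) = hsNormSq ((1 - U₀) - U₀ * (1 - U₁)) := by
    rw [← neg_sub, hsNormSq, hsNormSq, hsInner, hsInner, conjTranspose_neg, Matrix.neg_mul, Matrix.mul_neg, neg_neg]
  simp only [U, if_true, show (1:ℕ) ≠ 0 from one_ne_zero, if_false, hz, hsymm] at h
  push_cast at h
  linarith

end Summit.QuantumFields.BalabanUV.T4Continuum.NE7WilsonLagrange

end
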